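import Summits.ABC.IUTFork.Repair.RHReachLedgerDoorGenuineTies
import HarnessLib

/-!
# R-H ROUND 2, row 27 «reach-ledger» — THE ROW-27 DOOR AT THE GENUINE BED with the outer certificate on a cyclotomic index read off ONE
# uniformizer: attained when `f ≥ 2` OR when some uniformizer `π` of `K_x` passes the unit test `‖1 + π^e/p‖ = 1` (non-cyclotomic type)

PROOF-ONLY file (0 definitions, 0 `Prop` facts; abc-iut cell, D-0079 RESCUE sub-cell R-H, rung LADDER-ABC:A2.RESCUE.H; ROUND-2 seat
abc-iut-rh2-L1 gen 2). TAKES NO SIDE on [IUTchIII] Cor. 3.12 or on any author; row 27's ledger `RH.ReachLedger.HStarReachLedgerK`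
(abc-iut-lens-nearmiss-1, p464022) is an R-H CANDIDATE = a HYPOTHESIS SHAPE, never asserted; typed ≠ proved; nothing here asserts abc proved or refuted.

Sequel of `Repair/RHReachLedgerDoorGenuineTies.lean` (p481832). There the outer certificate on a CYCLOTOMIC index `e_p = p^a(p−1)` was supplied
when the residue degree is `≥ 2` (abc-iut-w6/rp-d4 lineage `UnitLogTieAttained`: a unit `c` off `𝔽_p` makes the two tying terms of `log_p(1 − c·ϖ)`
NOT cancel). At residue degree `1` the same read-out holds as soon as ONE uniformizer `π` passes the unit test `‖1 + π^{e}/p‖ = 1`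
(`ValuationProfile.norm_logSeries_eq_zpow_of_tie_of_unit`, (NZ)-free form of abc-iut-rp-d4's read-out): the residue of `π^e/p` is then not `−1`,
i.e. `K_x` is NOT of cyclotomic type (`K_x = ℚ_p(ζ_p)`-like, where `(1 − ζ_p)^{p−1}/p ≡ −1` and indeed `log_p(𝒪^×) = 𝔪²`). abc-iut-rh2-q3-num's
Q3-TIE27-v1.tsv (2026-08-27T01:22:01Z): on the 258-datum Q3 universe exactly ONE (datum, l, type) triple can carry a tied bad prime
(λ₇ at `l = 41`, `p = 1231`, `e_w = 1230 = p − 1` under the candidate type `e_v = 30`) — this file's third disjunct is the kernel test that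
decides it at `f = 1`. PROVED:
* §0 `exists_mem_logUnits_norm_eq_zpow_of_tie_of_unif` — at `e = p^{a₀}(p−1)`, a uniformizer `π` with `‖1 + π^{p^{a₀}(p−1)}/p‖ = 1` gives
  `z = L(1 − π) ∈ log_p(𝒪^×)` with `‖z‖ = ‖ϖ‖^{p^{a₀} − e·a₀}` EXACTLY (classical, Neukirch II (5.5)).
* **`statement_pilotDataOfK_of_hStarReachLedgerK_of_innerOuterUnit`** — as `…_of_innerOuter` with (O) widened to
  «`∀ a, e_p ≠ p^a(p−1)` ∨ `∀ x ∣ p, (f(𝔭_x∣p) ≥ 2 ∨ ∃ π ∈ K_x, ‖π‖ = p^{−1/e_p} ∧ ‖1 + π^{e_p}/p‖ = 1)`».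
So the residual of row 27's certificate binder is EXACTLY: a bad prime `p` with `e_p = p^a(p−1)` carrying a place `x` of residue degree `1` at
which EVERY uniformizer fails the unit test (cyclotomic type) — where the true outer order exceeds `rOutSharp` and the ledger's column itself
(not the door) is in question — or a bad place over `2` of even index (empty at genuine data, [IUTchI] Def. 3.1 (b)). HONEST SCOPE as before.
[cite: NeukirchANT1999, Ch. II (5.5)–(5.7), Prop. (6.8)] [cite: Washington1997, §5.1] [cite: DupuyHilado2025, §3.3, §3.4, §3.9, §4.9]
[cite: Mochizuki2012, IUTchI Ex. 3.2 (iv) p. 71; IUTchIII Cor. 3.12 p. 173–174] [claim: Mochizuki2012, status: disputed]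
-/

noncomputable section

open Set Function Metric
open scoped Pointwise

namespace Summit.ABC.IUTFork.Repair.RH.ReachLedgerDoor

open Thm311 Thm311.Real Cor312 Cor312.Setting Cor312Vol Cor312Prov Literature.IUT.LogThetaLattice Literature.IUT.LogVolume
  Literature.IUT.HodgeTheaters Summit.ABC.IUTFork.Repair.RH.ReachLedger
open Literature.NumberTheory.NumberFields NumberField IsDedekindDomain
open Literature.NumberTheory.GaloisRepresentations.Ultrametric

/-! ## §0. Attainment at a cyclotomic index from ONE uniformizer passing the unit test -/

section UnitTie

variable (p : ℕ) [hp : Fact p.Prime] {L : Type*} [NontriviallyNormedField L] [NormedAlgebra ℚ_[p] L] [IsUltrametricDist L]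
  [ProperSpace L]

/-- **THE ENVELOPE VALUE AT A CYCLOTOMIC INDEX IS ATTAINED from one uniformizer passing the unit test.** If `e = p^{a₀}·(p−1)` and a
uniformizer `π` (`‖π‖ = ‖ϖ‖`) has `‖1 + π^{p^{a₀}(p−1)}/p‖ = 1`, then `z = L(1 − π) ∈ log_p(𝒪_L^×)` has `‖z‖ = ‖ϖ‖^{p^{a₀} − e·a₀}` EXACTLY — the
two tying terms of indices `p^{a₀}`, `p^{a₀+1}` sum to the first times the unit `1 + π^e/p` (abc-iut-rp-d4 / abc-iut-w6's
`ValuationProfile.norm_logSeries_eq_zpow_of_tie_of_unit`, level `s = 1`). At residue degree `1` the test fails for every `π` exactly in the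
cyclotomic type `π^e/p ≡ −1`. [cite: NeukirchANT1999, Ch. II (5.5)–(5.7)] [cite: Washington1997, §5.1] -/
theorem exists_mem_logUnits_norm_eq_zpow_of_tie_of_unif {ϖ : Lˣ} (hϖ : IsUniformizer ϖ) {a₀ : ℕ}
    (he : absRamificationIdx p L = p ^ a₀ * (p - 1)) {π : L} (hπ : ‖π‖ = ‖(ϖ : L)‖)
    (hunit : ‖1 + π ^ (p ^ a₀ * (p - 1)) / (p : L)‖ = 1) :
    ∃ z ∈ logUnits L, ‖z‖ = ‖(ϖ : L)‖ ^ ((p : ℤ) ^ a₀ - (absRamificationIdx p L : ℤ) * (a₀ : ℤ)) := by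
  have hρ1 : ‖(ϖ : L)‖ < 1 := hϖ.1
  have htie : (absRamificationIdx p L : ℤ) = 1 * (p : ℤ) ^ a₀ * ((p : ℤ) - 1) := by
    rw [he]; push_cast [Nat.cast_sub hp.out.one_le]; ring
  set y : L := 1 - π with hy_def
  have hx : (1 : L) - y = π := by rw [hy_def]; ring
  have hy : ‖1 - y‖ = ‖(ϖ : L)‖ ^ (1 : ℤ) := by rw [hx, hπ, zpow_one]
  have hyP : IsPrincipal y := by
    show ‖1 - y‖ < 1
    rw [hy, zpow_one]
    exact hρ1
  have hunit' : ‖1 + (1 - y) ^ (p ^ a₀ * (p - 1)) / (p : L)‖ = 1 := by rw [hx]; exact hunit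
  have hlo : ∀ a < a₀, (1 : ℤ) * (p : ℤ) ^ a * ((p : ℤ) - 1) < absRamificationIdx p L := by
    intro a ha
    rw [htie]
    have hP : (2 : ℤ) ≤ (p : ℤ) := by exact_mod_cast hp.out.two_le
    have hpow : (p : ℤ) ^ a < (p : ℤ) ^ a₀ := pow_lt_pow_right₀ (by linarith) ha
    have h1 : (0 : ℤ) < (p : ℤ) - 1 := by linarith
    nlinarith
  refine ⟨logSeries y, ?_, ?_⟩
  · rw [← unitLog_of_isPrincipal p hyP]
    exact unitLog_mem_logUnits hyP.norm_eq_one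
  · rw [ValuationProfile.norm_logSeries_eq_zpow_of_tie_of_unit p hϖ hyP hy hlo htie hunit', one_mul]

end UnitTie

/-! ## §1. The row-27 door: inner on every odd tie; outer off the cyclotomic indices, and on them from `f ≥ 2` OR one good uniformizer -/


section GenuineTiesUnit

variable {F K Fbar : Type} [Field F] [NumberField F] [Field K] [NumberField K] [Algebra F K] [Field Fbar]
  [Algebra F Fbar] [Algebra K Fbar] {E : WeierstrassCurve F} [E.IsElliptic] {l : ℕ} {Pb : BadPlacePredicates K}
  (D : InitialThetaData F K Fbar E l Pb) {logv : PadicLogs K} (hlog : LogvAnalytic logv)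
  (M : Type) [Field M] [NumberField M]
  (archPk : ∀ (j : (thetaIndex (pilotDataOfK D K)).Label) (vQ : (thetaIndex (pilotDataOfK D K)).VQ),
    Set ((logShellsDH (pilotDataOfK D K) logv).Packet j vQ))
  (archSub : ∀ (j : (thetaIndex (pilotDataOfK D K)).Label) (v : (thetaIndex (pilotDataOfK D K)).V),
    Set ((logShellsDH (pilotDataOfK D K) logv).Packet j ((thetaIndex (pilotDataOfK D K)).over v)))
  (Ψ : ℤ → ∀ v : (thetaIndex (pilotDataOfK D K)).V, v ∈ (thetaIndex (pilotDataOfK D K)).Vbad →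
    Set ((logShellsDH (pilotDataOfK D K) logv).StarPacket v))
  (act : ℤ → ∀ v : (thetaIndex (pilotDataOfK D K)).V, v ∈ (thetaIndex (pilotDataOfK D K)).Vbad →
    (logShellsDH (pilotDataOfK D K) logv).StarPacket v → Module.End ℚ ((logShellsDH (pilotDataOfK D K) logv).StarPacket v))
  (Mmod : ℤ → ∀ j : (thetaIndex (pilotDataOfK D K)).LabelStar, Set ((logShellsDH (pilotDataOfK D K) logv).GlobalPacket j.1))
  (region : ℤ → ∀ j : (thetaIndex (pilotDataOfK D K)).LabelStar, FinDivisor M → ∀ vQ : (thetaIndex (pilotDataOfK D K)).VQ,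
    Set ((logShellsDH (pilotDataOfK D K) logv).Packet j.1 vQ))
  (n : ℤ) {HT : Type} {LogLink : HT → HT → Type} {IsFull : ∀ {s t : HT}, LogLink s t → Prop}
  (lat : LGPGaussianLogThetaLattice LogLink IsFull)
  {Frd : Type} {IsoF : Frd → Frd → Type} {Ob : Frd → Type} {realify : Frd → Frd} {Strip : Type}
  {IsoS : Strip → Strip → Type}
  {Mv : ∀ v : (thetaIndex (pilotDataOfK D K)).V, v ∈ (thetaIndex (pilotDataOfK D K)).Vbad → Type} [∀ v h, Monoid (Mv v h)]
  (sig : GlobalLGPFrobenioidSignature (thetaIndex (pilotDataOfK D K)).lstar (thetaIndex (pilotDataOfK D K)).V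
    (· ∈ (thetaIndex (pilotDataOfK D K)).Vbad) Frd IsoF Ob realify Strip IsoS Mv)
  (split : SplittingMonoids Mv) {ObΔ : Type}
  {N : ∀ v : (thetaIndex (pilotDataOfK D K)).V, v ∈ (thetaIndex (pilotDataOfK D K)).Vbad → Type} [∀ v h, Monoid (N v h)]
  (qData : QPilotData ObΔ N)
  (tq : ∀ (pp : Nat.Primes) (x : (thetaIndex (pilotDataOfK D K)).Fibre (.inr pp)),
    haveI : Fact (pp : ℕ).Prime := ⟨pp.2⟩; kOf (pilotDataOfK D K) pp.1 x)
  (t : ∀ (pp : Nat.Primes) (_ : Fin (pilotDataOfK D K).lstar) (x : (thetaIndex (pilotDataOfK D K)).Fibre (.inr pp)),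
    haveI : Fact (pp : ℕ).Prime := ⟨pp.2⟩; kOf (pilotDataOfK D K) pp.1 x)
  (htq0 : ∀ pp x, tq pp x ≠ 0)
  (htq1 : ∀ (pp : Nat.Primes) (x : (thetaIndex (pilotDataOfK D K)).Fibre (.inr pp)),
    haveI : Fact (pp : ℕ).Prime := ⟨pp.2⟩; placeOf (pilotDataOfK D K) pp.1 x ∉ (pilotDataOfK D K).S → ‖tq pp x‖ = 1)
  (ht0 : ∀ pp i x, t pp i x ≠ 0)
  (ht1 : ∀ (pp : Nat.Primes) (i : Fin (pilotDataOfK D K).lstar) (x : (thetaIndex (pilotDataOfK D K)).Fibre (.inr pp)),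
    haveI : Fact (pp : ℕ).Prime := ⟨pp.2⟩; placeOf (pilotDataOfK D K) pp.1 x ∉ (pilotDataOfK D K).S → ‖t pp i x‖ = 1)
  (ht : ∀ (pp : Nat.Primes) (i : Fin (pilotDataOfK D K).lstar) (x : (thetaIndex (pilotDataOfK D K)).Fibre (.inr pp)),
    haveI : Fact (pp : ℕ).Prime := ⟨pp.2⟩
    Real.log ‖t pp i x‖ = -((pilotDataOfK D K).thetaPilot i (placeOf (pilotDataOfK D K) pp.1 x)) *
      logNorm K (placeOf (pilotDataOfK D K) pp.1 x) / localDegree K (placeOf (pilotDataOfK D K) pp.1 x))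
  (htq : ∀ (pp : Nat.Primes) (x : (thetaIndex (pilotDataOfK D K)).Fibre (.inr pp)),
    haveI : Fact (pp : ℕ).Prime := ⟨pp.2⟩
    Real.log ‖tq pp x‖ = -((pilotDataOfK D K).qPilot (placeOf (pilotDataOfK D K) pp.1 x)) *
      logNorm K (placeOf (pilotDataOfK D K) pp.1 x) / localDegree K (placeOf (pilotDataOfK D K) pp.1 x))
  (mq : ∀ pp : Nat.Primes, (thetaIndex (pilotDataOfK D K)).Fibre (.inr pp) → ℤ)

include ht0 ht1 ht htq in
/-- **THE ROW-27 DOOR AT THE GENUINE BED, TIES INCLUDED, the outer tie read off ONE uniformizer.** At `pilotDataOfK D K` with REALISING ideles: IF every prime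
`p` under a bad place has a UNIFORM fibre index `e_p` with (I) `p ≠ 2 ∨ e_p` odd and (O) `e_p ≠ p^a(p−1)` for all `a`, or `f(𝔭_x ∣ p) ≥ 2` for
every `x ∣ p`, or — per `x ∣ p` — SOME uniformizer `π` of `K_x` with `‖1 + π^{e_p}/p‖ = 1`; the Kummer orders at the bad places are the integers `m_q(w) = P_q(w)`; and `HStarReachLedgerK D e m_q` holds at the intrinsic index
— THEN the typed [IUTchIII] Cor. 3.12 `Statement` of `settingPrVolSharp (pilotDataOfK D K) … tq t …` holds. Certificates: inner at
`A_p = innerCond p e_p` (`not_closedBall_div_subset_logUnits` / `not_closedBall_div_pred_subset_logUnits_of_dvd` / at `p = 2`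
`not_closedBall_pred_subset_logUnits`), outer at `B_p = p^{a₀} − e_p·a₀` (`RHSlotReach.exists_hrad_sharp` /
`ValuationProfile.exists_mem_logUnits_norm_eq_zpow_of_tie_of_two_le_residueDegree`), `B_p ≤ rOutSharp` by `envelope_le_rOutSharp`; the rest as
`statement_pilotDataOfK_of_hStarReachLedgerK_untied`. «Statement follows from the ledger AS TYPED». [cite: NeukirchANT1999, Ch. II (5.5)–(5.7),
Prop. (6.8)] [cite: Washington1997, §5.1] [cite: DupuyHilado2025, §3.3, §3.4, §3.9, §4.9] [cite: Mochizuki2012, IUTchI Ex. 3.2 (iv) p. 71;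
IUTchIII Cor. 3.12 p. 173–174] [claim: Mochizuki2012, status: disputed] -/
theorem statement_pilotDataOfK_of_hStarReachLedgerK_of_innerOuterUnit (eK : Nat.Primes → ℕ)
    (heK : ∀ (pp : Nat.Primes) (w : (thetaIndex (pilotDataOfK D K)).Fibre (.inr pp)), haveI : Fact (pp : ℕ).Prime := ⟨pp.2⟩
      placeOf (pilotDataOfK D K) pp.1 w ∈ (pilotDataOfK D K).S → ∀ x : (thetaIndex (pilotDataOfK D K)).Fibre (.inr pp),
        (placeOf (pilotDataOfK D K) pp.1 x).asIdeal.ramificationIdx ℤ = eK pp)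
    (hI : ∀ (pp : Nat.Primes) (w : (thetaIndex (pilotDataOfK D K)).Fibre (.inr pp)), haveI : Fact (pp : ℕ).Prime := ⟨pp.2⟩
      placeOf (pilotDataOfK D K) pp.1 w ∈ (pilotDataOfK D K).S → (pp : ℕ) ≠ 2 ∨ ¬ 2 ∣ eK pp)
    (hO : ∀ (pp : Nat.Primes) (w : (thetaIndex (pilotDataOfK D K)).Fibre (.inr pp)), haveI : Fact (pp : ℕ).Prime := ⟨pp.2⟩
      placeOf (pilotDataOfK D K) pp.1 w ∈ (pilotDataOfK D K).S →
        (∀ a : ℕ, (eK pp : ℤ) ≠ ((pp : ℕ) : ℤ) ^ a * (((pp : ℕ) : ℤ) - 1)) ∨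
          ∀ x : (thetaIndex (pilotDataOfK D K)).Fibre (.inr pp), 2 ≤ (placeOf (pilotDataOfK D K) pp.1 x).asIdeal.inertiaDeg ℤ ∨
            ∃ π : kOf (pilotDataOfK D K) pp.1 x, ‖π‖ = ((pp : ℕ) : ℝ) ^ (-(1 : ℝ) / (eK pp : ℝ)) ∧
              ‖1 + π ^ (eK pp) / ((pp : ℕ) : kOf (pilotDataOfK D K) pp.1 x)‖ = 1)
    (hmq : ∀ (pp : Nat.Primes) (w : (thetaIndex (pilotDataOfK D K)).Fibre (.inr pp)), haveI : Fact (pp : ℕ).Prime := ⟨pp.2⟩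
      placeOf (pilotDataOfK D K) pp.1 w ∈ (pilotDataOfK D K).S →
        (mq pp w : ℝ) = (pilotDataOfK D K).qPilot (placeOf (pilotDataOfK D K) pp.1 w))
    (hH : HStarReachLedgerK D
      (fun pp x => haveI : Fact (pp : ℕ).Prime := ⟨pp.2⟩; (placeOf (pilotDataOfK D K) pp.1 x).asIdeal.ramificationIdx ℤ) mq) :
    (settingPrVolSharp (pilotDataOfK D K) hlog M archPk archSub Ψ act Mmod region n lat sig split qData tq t htq0 htq1).Statement := by
  haveI hne : ∀ pp : Nat.Primes, Fact (pp : ℕ).Prime := fun pp => ⟨pp.2⟩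
  classical
  obtain ⟨ϖ, hϖ⟩ := RH2SigmaHull.exists_normUniformizers D
  -- a turning point `a₀(p)` of `e_p` at every prime
  have hturn : ∀ pp : Nat.Primes, ∃ a₀ : ℕ, (∀ a < a₀, ((pp : ℕ) : ℤ) ^ a * (((pp : ℕ) : ℤ) - 1) < eK pp) ∧
      ((eK pp : ℕ) : ℤ) ≤ ((pp : ℕ) : ℤ) ^ a₀ * (((pp : ℕ) : ℤ) - 1) :=
    fun pp => LogEnvelope.exists_turning (p := (pp : ℕ)) (eK pp)
  choose a₀ ha₀lo ha₀hi using hturn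
  -- the certified columns: `A_p := innerCond p e_p` (natural-number mirror), `B_p := p^{a₀} − e_p·a₀`
  let AK : Nat.Primes → ℕ := fun pp =>
    if (pp : ℕ) - 1 ∣ eK pp then eK pp / ((pp : ℕ) - 1) else eK pp / ((pp : ℕ) - 1) + 1
  let BK : Nat.Primes → ℤ := fun pp => ((pp : ℕ) : ℤ) ^ a₀ pp - (eK pp : ℤ) * (a₀ pp : ℤ)
  have hAK : ∀ pp, (AK pp : ℤ) = innerCond pp (eK pp) := fun pp => by
    show (((if (pp : ℕ) - 1 ∣ eK pp then eK pp / ((pp : ℕ) - 1) else eK pp / ((pp : ℕ) - 1) + 1 : ℕ)) : ℤ) = _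
    unfold innerCond
    split_ifs <;> push_cast <;> rfl
  -- readings of the index and residue degree of `K_x`
  have hidx : ∀ (pp : Nat.Primes) (x : (thetaIndex (pilotDataOfK D K)).Fibre (.inr pp)),
      absRamificationIdx (pp : ℕ) (kOf (pilotDataOfK D K) pp.1 x) = (placeOf (pilotDataOfK D K) pp.1 x).asIdeal.ramificationIdx ℤ :=
    fun pp x => absRamificationIdx_rescaledCompletion K pp.1 (placeOf (pilotDataOfK D K) pp.1 x) (natCast_mem_placeOf (pilotDataOfK D K) pp.1 x)
  have hfdx : ∀ (pp : Nat.Primes) (x : (thetaIndex (pilotDataOfK D K)).Fibre (.inr pp)),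
      residueDegree (pp : ℕ) (kOf (pilotDataOfK D K) pp.1 x) = (placeOf (pilotDataOfK D K) pp.1 x).asIdeal.inertiaDeg ℤ :=
    fun pp x => residueDegree_rescaledCompletion K pp.1 (placeOf (pilotDataOfK D K) pp.1 x) (natCast_mem_placeOf (pilotDataOfK D K) pp.1 x)
  have hϖ0 : ∀ pp x, ϖ pp x ≠ 0 := fun pp x => by
    rw [← norm_pos_iff, hϖ pp x]; exact Real.rpow_pos_of_pos (by exact_mod_cast pp.2.pos) _
  have hϖ' : ∀ (pp : Nat.Primes) (w : (thetaIndex (pilotDataOfK D K)).Fibre (.inr pp)),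
      placeOf (pilotDataOfK D K) pp.1 w ∈ (pilotDataOfK D K).S → ∀ x : (thetaIndex (pilotDataOfK D K)).Fibre (.inr pp),
        ‖ϖ pp x‖ = ((pp : ℕ) : ℝ) ^ (-(1 : ℝ) / (eK pp : ℝ)) := fun pp w hw x => by
    rw [hϖ pp x, ramIdx_eq, heK pp w hw x]
  have he : ∀ (pp : Nat.Primes) (w : (thetaIndex (pilotDataOfK D K)).Fibre (.inr pp)),
      placeOf (pilotDataOfK D K) pp.1 w ∈ (pilotDataOfK D K).S → 1 ≤ eK pp := fun pp w hw => by
    have h1 := RH2SigmaHull.one_le_ramIdx_placeOf D pp w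
    rw [ramIdx_eq, heK pp w hw w] at h1
    exact h1
  refine statement_of_hStarReachLedger_on (pilotDataOfK D K) hlog M archPk archSub Ψ act Mmod region n lat sig split qData tq t htq0 htq1
    eK AK BK ϖ (fun pp i w => ((((i : ℕ) : ℤ) + 1) ^ 2) * mq pp w) mq ht0 hϖ0 ht1
    (fun pp i w hw => RH2SigmaHull.norm_thetaIdele_eq_zpow_of_realises D tq t htq0 ht0 ht htq mq pp i w (ϖ pp w) (hϖ pp w) (hmq pp w hw))
    (fun pp w hw => RH2SigmaHull.norm_qIdele_eq_zpow_of_realises D tq htq0 htq mq pp w (ϖ pp w) (hϖ pp w) (hmq pp w hw))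
    (fun pp i w _ => rfl) he hϖ' (fun pp w hw x => ?_) (fun pp w hw x => ?_) (fun pp w hw => by rw [hAK])
    (fun pp w hw => envelope_le_rOutSharp pp.2 (ha₀lo pp) (ha₀hi pp))
    (fun pp x => (placeOf (pilotDataOfK D K) pp.1 x).asIdeal.ramificationIdx ℤ) (fun pp w hw => heK pp w hw w) hH
    (bridgeHyps_settingPrVolSharp_of_ideles (pilotDataOfK D K) hlog M archPk archSub Ψ act Mmod region n lat sig split qData t tq ht0 ht1
      htq0 htq1)
  · -- INNER certificate at `A_p = innerCond p e_p`
    have hu : IsUniformizer (unifChoice (kOf (pilotDataOfK D K) pp.1 x)) := isUniformizer_unifChoice _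
    have hex : absRamificationIdx (pp : ℕ) (kOf (pilotDataOfK D K) pp.1 x) = eK pp := (hidx pp x).trans (heK pp w hw x)
    have hnorm : ‖(unifChoice (kOf (pilotDataOfK D K) pp.1 x) : kOf (pilotDataOfK D K) pp.1 x)‖ = ‖ϖ pp x‖ := by
      rw [norm_eq_rpow_of_isUniformizer (pp : ℕ) (kOf (pilotDataOfK D K) pp.1 x) hu, hex, hϖ' pp w hw x, neg_div]
    have hp1 : 1 ≤ (pp : ℕ) := pp.2.one_le
    by_cases hdvd : (pp : ℕ) - 1 ∣ eK pp
    · -- ON THE TIE: `A_p = e_p/(p−1)`, witness ball of exponent `e_p/(p−1) − 1`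
      have hq0 : 0 < (pp : ℕ) - 1 := by have := pp.2.two_le; omega
      have hA1 : 1 ≤ eK pp / ((pp : ℕ) - 1) :=
        (Nat.one_le_div_iff hq0).mpr (Nat.le_of_dvd (he pp w hw) hdvd)
      have hcast : (AK pp : ℤ) - 1 = ((eK pp / ((pp : ℕ) - 1) - 1 : ℕ) : ℤ) := by
        show (((if (pp : ℕ) - 1 ∣ eK pp then eK pp / ((pp : ℕ) - 1) else eK pp / ((pp : ℕ) - 1) + 1 : ℕ)) : ℤ) - 1 = _
        rw [if_pos hdvd, Nat.cast_sub hA1, Nat.cast_one]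
      have hns : ¬ closedBall (0 : kOf (pilotDataOfK D K) pp.1 x)
          (‖(unifChoice (kOf (pilotDataOfK D K) pp.1 x) : kOf (pilotDataOfK D K) pp.1 x)‖ ^ (eK pp / ((pp : ℕ) - 1) - 1)) ⊆
            logUnits (kOf (pilotDataOfK D K) pp.1 x) := by
        by_cases hp2 : (pp : ℕ) = 2
        · -- `p = 2`: `A = e` is odd by (I), so `p ∤ A`
          have hodd : ¬ 2 ∣ eK pp := (hI pp w hw).resolve_left fun h => h hp2
          have hpA : ¬ (pp : ℕ) ∣ eK pp / ((pp : ℕ) - 1) := by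
            rw [hp2]
            simpa using hodd
          exact LogEnvelope.not_closedBall_pred_subset_logUnits (pp : ℕ) hu (A := eK pp / ((pp : ℕ) - 1))
            (by rw [hex]; exact (Nat.div_mul_cancel hdvd).symm) hpA
        · -- `p` odd: the universal lower bound `r_in ≥ e/(p−1)`
          have h := LogEnvelope.not_closedBall_div_pred_subset_logUnits_of_dvd (pp : ℕ) hu hp2 (by rw [hex]; exact hdvd)
          rwa [hex] at h
      obtain ⟨u, hu_mem, hu_not⟩ := Set.not_subset.mp hns
      refine ⟨u, ?_, hu_not⟩
      rw [hcast, zpow_natCast, ← hnorm]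
      exact mem_closedBall_zero_iff.mp hu_mem
    · -- OFF THE TIE: `A_p = ⌊e_p/(p−1)⌋ + 1`, witness ball of exponent `⌊e_p/(p−1)⌋`
      have hcast : (AK pp : ℤ) - 1 = ((eK pp / ((pp : ℕ) - 1) : ℕ) : ℤ) := by
        show (((if (pp : ℕ) - 1 ∣ eK pp then eK pp / ((pp : ℕ) - 1) else eK pp / ((pp : ℕ) - 1) + 1 : ℕ)) : ℤ) - 1 = _
        rw [if_neg hdvd]
        push_cast
        ring
      have hns := LogEnvelope.not_closedBall_div_subset_logUnits (pp : ℕ) hu (by rw [hex]; exact hdvd)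
      rw [hex] at hns
      obtain ⟨u, hu_mem, hu_not⟩ := Set.not_subset.mp hns
      refine ⟨u, ?_, hu_not⟩
      rw [hcast, zpow_natCast, ← hnorm]
      exact mem_closedBall_zero_iff.mp hu_mem
  · -- OUTER certificate at `B_p = p^{a₀} − e_p·a₀`
    have hu : IsUniformizer (unifChoice (kOf (pilotDataOfK D K) pp.1 x)) := isUniformizer_unifChoice _
    have hex : absRamificationIdx (pp : ℕ) (kOf (pilotDataOfK D K) pp.1 x) = eK pp := (hidx pp x).trans (heK pp w hw x)
    by_cases hne' : ∀ a : ℕ, (eK pp : ℤ) ≠ ((pp : ℕ) : ℤ) ^ a * (((pp : ℕ) : ℤ) - 1)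
    · -- strict turning point: `log_p(1 + ϖ_x)` attains the envelope
      have hhi' : ((eK pp : ℕ) : ℤ) < ((pp : ℕ) : ℤ) ^ a₀ pp * (((pp : ℕ) : ℤ) - 1) :=
        LogEnvelope.lt_of_le_of_forall_ne (ha₀hi pp) hne'
      obtain ⟨z, hz, hzn⟩ := RHSlotReach.exists_hrad_sharp (pp : ℕ) (kOf (pilotDataOfK D K) pp.1 x) hu (a₀ := a₀ pp)
        (by rw [hex]; exact ha₀lo pp) (by rw [hex]; exact hhi')
      rw [hex] at hzn
      exact ⟨z, hz, hzn⟩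
    · -- a cyclotomic index `e_p = p^a(p−1)` (`a = a₀`): attained by (O)'s per-place alternative
      push Not at hne'
      obtain ⟨a, ha⟩ := hne'
      have haa : a₀ pp = a := turning_eq_of_tie pp.2 (ha₀lo pp) (ha₀hi pp) ha
      have hp1 : 1 ≤ (pp : ℕ) := pp.2.one_le
      have heqN : eK pp = (pp : ℕ) ^ a₀ pp * ((pp : ℕ) - 1) := by
        rw [haa]
        have h : ((eK pp : ℕ) : ℤ) = (((pp : ℕ) ^ a * ((pp : ℕ) - 1) : ℕ) : ℤ) := by
          rw [ha]; push_cast [Nat.cast_sub hp1]; ring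
        exact_mod_cast h
      have hnorm' : ‖(unifChoice (kOf (pilotDataOfK D K) pp.1 x) : kOf (pilotDataOfK D K) pp.1 x)‖ =
          ((pp : ℕ) : ℝ) ^ (-(1 : ℝ) / (eK pp : ℝ)) := by
        rw [norm_eq_rpow_of_isUniformizer (pp : ℕ) (kOf (pilotDataOfK D K) pp.1 x) hu, hex, neg_div]
      rcases ((hO pp w hw).resolve_left fun h => h a ha) x with hf | ⟨π, hπn, hπu⟩
      · -- residue degree `≥ 2`: a unit off `𝔽_p` (abc-iut-w6/rp-d4)
        have hf' : 2 ≤ residueDegree (pp : ℕ) (kOf (pilotDataOfK D K) pp.1 x) := by rwa [hfdx pp x]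
        have heq : absRamificationIdx (pp : ℕ) (kOf (pilotDataOfK D K) pp.1 x) = 1 * (pp : ℕ) ^ a₀ pp * ((pp : ℕ) - 1) := by
          rw [hex, heqN, one_mul]
        obtain ⟨z, hz, hzn⟩ := ValuationProfile.exists_mem_logUnits_norm_eq_zpow_of_tie_of_two_le_residueDegree (pp : ℕ) hu
          (s := 1) le_rfl (a₀ := a₀ pp) heq hf'
        refine ⟨z, hz, le_of_eq ?_⟩
        rw [hzn, hex, RH2SigmaHull.zpow_of_norm_eq_rpow pp.2.pos hnorm', Nat.cast_one, one_mul]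
      · -- ONE uniformizer passing the unit test (§0)
        have heq : absRamificationIdx (pp : ℕ) (kOf (pilotDataOfK D K) pp.1 x) = (pp : ℕ) ^ a₀ pp * ((pp : ℕ) - 1) := by
          rw [hex, heqN]
        have hπ' : ‖π‖ = ‖(unifChoice (kOf (pilotDataOfK D K) pp.1 x) : kOf (pilotDataOfK D K) pp.1 x)‖ := by rw [hπn, hnorm']
        rw [heqN] at hπu
        obtain ⟨z, hz, hzn⟩ := exists_mem_logUnits_norm_eq_zpow_of_tie_of_unif (pp : ℕ) hu heq hπ' hπu
        refine ⟨z, hz, le_of_eq ?_⟩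
        rw [hzn, hex, RH2SigmaHull.zpow_of_norm_eq_rpow pp.2.pos hnorm']

end GenuineTiesUnit

end Summit.ABC.IUTFork.Repair.RH.ReachLedgerDoor

end
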